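import Summits.ABC.IUTFork.Repair.RHTameBandLicenceMu
import Summits.ABC.IUTFork.Repair.RHHullCellSlackLaw
import Summits.ABC.IUTFork.Repair.RHHullCellSlackSum
import HarnessLib

/-!
# R-H ROUND 3 (C-ii) SLACK-LAW, ROW 5 rides the HULL-CELL pair: row 5's tame band cell IS the exact hull cell at tame different `δ = e − 1` and unit
# radii `r_in = r_out = 1` — so the refereed (C-ii) kernel pair (p484618 `RHHullCellSlackLaw`, p484728 `RHHullCellSlackSum`) applies to row 5 BY NAME

Seat abc-iut-rh-typ-5 (R-H PAIR n = 5 TYPER, gen 5; round-2/3 row-5 hand). PROOF-ONLY bridge (0 definitions): this seat's `RH.TameBandLicence.Cell e P j`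
(`(j²−1)·P ≤ j·(e−1) + ((j²P − 1) mod e)`, p458742) is, for `0 < e`, LITERALLY abc-iut-rh-typ-4's `HullThresholdExact.HullCell e P j 1 1` (p458452;
`hullCell_one_one_iff`, abc-iut-w5-d180's exact tame dichotomy) and abc-iut-lens-transfer-3 / rp-d3's `DiffPricedHull.HullCellδ e P j (e−1) 1 1`
(`hullCellδ_tame_iff`): row 5 = the hull cell's column `(δ, r_in, r_out) = (e−1, 1, 1)`, log-shell span `G = r_in − r_out = 0`. Consequently the
ROUND-3 (C-ii) SLACK-LAW KERNEL PAIR refereed for the HEX hull cell (abc-iut-rh2-tab-2 `RHHullCellSlackLaw` p484618, abc-iut-rh-typ-3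
`RHHullCellSlackSum` p484728; rh2-ref-3 REF-3 PASS ×2 2026-08-27T01:59:35Z) holds for row 5 with `price_j = j(e−1) + ρ_j` (= this seat's CREDIT,
`RHTameBandLicenceMu` §2) and demand `d_j = (j²−1)·P`:
* §1 `cell_iff_hullCell_one_one`, `cell_iff_hullCellδ`, `credit_eq_price` (the residues agree: `(j²P − j(e−1) − (j+1)) mod e = (j²P − 1) mod e`).
* §2 row-5 instances BY NAME: **`margin_mono_of_not_cell`** (the EXACT licence margin `(j²−1)P − (j(e−1) + ρ_j)` is NON-DECREASING above a failing
  label — rh2-tab-2 `deficit_mono_of_not_hullCellδ` at `(e−1, 1, 1)`; complements `RHTameBandLicenceMu`'s two-sided quadratic bracket),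
  **`sum_credit_mul_le_sum_mass_mul`** (summed ceiling, cross-multiplied: `P·[6(S(J+n) − S(J))]·(2·Σ_{k<n} credit_{J+1+k}) ≤ 2(e−1)·n(2J+n+1)·(6·Σ_{k<n} d_{J+1+k})`,
  rh-typ-3 `sum_price_mul_le_sum_demand_mul` at `(e−1, 1, 1)`): a band-riding partial-credit object recovers at most the share
  `6(e−1)·n(2J+n+1) / (P·6(S(L) − S(J)))` of the conceded `j²−1` mass above the boundary, `L = J+n = l⋆` — `O(J/l⋆)` since `(e−1)/P < J+2`.
HONEST FRAMING: integer identities about OUR typed cells; nothing here asserts abc proved or refuted; no side is taken on [IUTchIII] Cor. 3.12 or on any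
author; typed ≠ proved for every IUT locution. [cite: Mochizuki2012, IUTchI Ex. 3.2 (iv) p. 71; IUTchIII Cor. 3.12 Step (xi-f) p. 184; IUTchIV Prop. 1.2
(i)(ii) p. 10, Prop. 1.4 p. 13] [cite: DupuyHilado2025, §3.4, §4.9] [claim: Mochizuki2012, status: disputed]. Axioms: standard.
-/

namespace Summit.ABC.IUTFork.Repair.RH.TameBandLicence

open Finset
open Summit.ABC.IUTFork.Repair.RH.HullThresholdExact Summit.ABC.IUTFork.Repair.RH.DiffPricedHull
  Summit.ABC.IUTFork.Repair.RH.HullCellSlackLaw Summit.ABC.IUTFork.Repair.RH.HullCellSlackSum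

/-! ## §1. Row 5's cell is the hull cell at `(δ, r_in, r_out) = (e−1, 1, 1)` -/

/-- **`Cell e P j ↔ HullCell e P j 1 1`** (`0 < e`): both are abc-iut-w5-d180's exact tame dichotomy `e·⌊(j²P−1)/e⌋ + 1 − j(e−1) ≤ P`
(`cell_iff_tame_exact`, abc-iut-rh-typ-4's `hullCell_one_one_iff`). [folklore] -/
theorem cell_iff_hullCell_one_one {e : ℤ} (he : 0 < e) (P j : ℤ) : Cell e P j ↔ HullCell e P j 1 1 := by
  rw [cell_iff_tame_exact he, hullCell_one_one_iff he.ne']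

/-- **`Cell e P j ↔ HullCellδ e P j (e−1) 1 1`** (`0 < e`): row 5 is the different-priced hull cell at the TAME different exponent `δ = e − 1` with
unit radii (`hullCellδ_tame_iff`). [folklore] -/
theorem cell_iff_hullCellδ {e : ℤ} (he : 0 < e) (P j : ℤ) : Cell e P j ↔ HullCellδ e P j (e - 1) 1 1 := by
  rw [hullCellδ_tame_iff, cell_iff_hullCell_one_one he]

/-- **The band's credit IS the hull cell's price at `(e−1, 1, 1)`**: `j(e−1) + ((j²P−1) mod e) = j·δ + (j+1)·(r_in − r_out) + ρ_j` with `δ = e−1`,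
`r_in = r_out = 1` (`ρ_j = (j²P − j(e−1) − (j+1)) mod e = (j²P − 1 − j·e) mod e = (j²P − 1) mod e`). [folklore] -/
theorem credit_eq_price (e P j : ℤ) :
    j * (e - 1) + (j ^ 2 * P - 1) % e = j * (e - 1) + (j + 1) * ((1 : ℤ) - 1) + (j ^ 2 * P - j * (e - 1) - (j + 1) * 1) % e := by
  have h : j ^ 2 * P - j * (e - 1) - (j + 1) * 1 = (j ^ 2 * P - 1) + (-j) * e := by ring
  rw [h, Int.add_mul_emod_self_right]
  ring

/-! ## §2. The (C-ii) slack-law pair, instantiated for row 5 -/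

/-- **ROW 5: the EXACT licence margin is NON-DECREASING above a failing label** — `¬ Cell e P j`, `1 ≤ j ≤ j'`, `0 < e`, `0 ≤ P` ⟹
`(j²−1)P − (j(e−1) + ρ_j) ≤ (j'²−1)P − (j'(e−1) + ρ_{j'})` (abc-iut-rh2-tab-2 `deficit_mono_of_not_hullCellδ` at `(δ, r_in, r_out) = (e−1, 1, 1)`):
gradual onset, quadratic growth, no cliff and no recovery, now including the remainder. [folklore] -/
theorem margin_mono_of_not_cell {e P j j' : ℤ} (he : 0 < e) (hP : 0 ≤ P) (hj : 1 ≤ j) (hjj : j ≤ j') (h : ¬ Cell e P j) :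
    (j ^ 2 - 1) * P - (j * (e - 1) + (j ^ 2 * P - 1) % e) ≤ (j' ^ 2 - 1) * P - (j' * (e - 1) + (j' ^ 2 * P - 1) % e) := by
  rw [cell_iff_hullCellδ he] at h
  have hm := deficit_mono_of_not_hullCellδ he le_rfl le_rfl hP hj hjj h
  rw [credit_eq_price e P j, credit_eq_price e P j']
  exact hm

/-- **ROW 5: SUMMED PARTIAL-CREDIT CEILING (cross-multiplied, no division).** For `0 < e`, `0 ≤ P`, `0 ≤ J`, over the labels `J+1, …, J+n`:
`P·[(J+n)(J+n−1)(2(J+n)+5) − J(J−1)(2J+5)]·(2·Σ credit) ≤ 2(e−1)·n(2J+n+1)·(6·Σ (j²−1)·P)` — abc-iut-rh-typ-3's `sum_price_mul_le_sum_demand_mul` at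
`(e−1, 1, 1)` (`δ + 2G + (e−1) = 2(e−1)`). READING: the share of the conceded mass above the boundary that the band's credit can cover is at most
`6(e−1)·n(2J+n+1) / (P·6(S(J+n) − S(J)))` = `O(J/l⋆)` (`(e−1)/P < J+2`); never `→ 1` at a deep place. [folklore] -/
theorem sum_credit_mul_le_sum_mass_mul {e P J : ℤ} (he : 0 < e) (hP : 0 ≤ P) (hJ : 0 ≤ J) (n : ℕ) :
    P * ((J + n) * (J + n - 1) * (2 * (J + n) + 5) - J * (J - 1) * (2 * J + 5)) *
        (2 * ∑ k ∈ range n, ((J + 1 + (k : ℤ)) * (e - 1) + ((J + 1 + (k : ℤ)) ^ 2 * P - 1) % e)) ≤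
      2 * (e - 1) * ((n : ℤ) * (2 * J + n + 1)) * (6 * ∑ k ∈ range n, ((J + 1 + (k : ℤ)) ^ 2 - 1) * P) := by
  have h := sum_price_mul_le_sum_demand_mul (m := P) (δ := e - 1) (rin := 1) (rout := 1) (J := J) he le_rfl hJ hP n
  have hsum : ∑ k ∈ range n, ((J + 1 + (k : ℤ)) * (e - 1) + ((J + 1 + (k : ℤ)) ^ 2 * P - 1) % e) =
      ∑ k ∈ range n, ((J + 1 + (k : ℤ)) * (e - 1) + (J + 1 + (k : ℤ) + 1) * ((1 : ℤ) - 1) +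
        ((J + 1 + (k : ℤ)) ^ 2 * P - (J + 1 + (k : ℤ)) * (e - 1) - (J + 1 + (k : ℤ) + 1) * 1) % e) :=
    sum_congr rfl fun k _ => credit_eq_price e P (J + 1 + (k : ℤ))
  have hcoef : (e - 1) + 2 * ((1 : ℤ) - 1) + (e - 1) = 2 * (e - 1) := by ring
  rw [hsum, ← hcoef]
  exact h

/-- **Sanity (row-5 integers): `(e, P) = (22, 5)`, boundary `J = 4` at `l = 11` (`l⋆ = 5`, one label above)**: credit at `j = 5` is
`5·21 + 14 = 119`, demand `24·5 = 120`, margin `1` (`RHTameBandLicenceMu.first_miss_margin_examples`); and the hull cell at `(21, 1, 1)` agrees: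
OFF at `5`, ON at `4`. [folklore] -/
theorem row5_example_22_5 : ¬ HullCellδ 22 5 5 21 1 1 ∧ HullCellδ 22 5 4 21 1 1 ∧ ¬ Cell 22 5 5 ∧ Cell 22 5 4 := by
  simp only [HullCellδ, Cell]
  decide

end Summit.ABC.IUTFork.Repair.RH.TameBandLicence
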